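import Mathlib
import Summits.NavierStokesRegularity.NavierStokesRegularity.Theorems.FilamentSkeletonRssMatchedKernelNormalBlockDet
import Summits.NavierStokesRegularity.NavierStokesRegularity.Theorems.FilamentSkeletonRssMatchedKernelDivFreeTrace
import Summits.NavierStokesRegularity.NavierStokesRegularity.Theorems.FilamentSkeletonRssSelectionBoxRJRungNormalBlockBox

/-!
# Matched-core normal block, BOX: clause 12 is implied by the other skeleton clauses for MATCHED cores `κ·Aa ∈ [m₁, m₂]`
# (`2Kρ ≤ 1`, `Γ ≥ Γ₁₂(m₁, m₂, K, ρ, Rw, Rb, cg, θ₀, N)`)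

μ-parametrised port of `SelectionBoxRJRung.clause12_thresholds` / `clause12_of_skeleton` (`…RungNormalBlockBox`, lane 19175-p1 g8) to the matched
kernel of the A1G cone (kit §5(d)), assembling `MatchedKernel.matchedSkeletonField_trace_eq` (trace `3/2`), `SelectionBoxRJRung.box_eigenvector_law`,
`normalBlock_trace_neg` (trace half) and `MatchedKernel.matched_normalBlock_det_pos` (determinant half).  THRESHOLDS: the unit-core numerology
(`E₂ + 4E₁ ≤ 1/3`, partners + frame `< Q·1`) rescaled by the cores — self errors `O(ΓK/(√Γ √m₁))` against the rotation `(4/3)/m₂`: `K ↦ K m₂/√m₁`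
in the second threshold and a factor `m₂` in the third and fourth:
`Γ ≥ exp((Rw/Rb)² + 1)`, `Γ ≥ (7104 π K m₂)²/m₁`, `Γ ≥ 312 π m₂ (cg ρ + 2Rw)/(cg⁴ ρ³)`, `Γ ≥ 4π m₂ (12 N (ρ + 2Rw)/(θ₀ cg ρ³) + 2θ₀⁻¹ + 2)/θ₀`.
The core bounds enter as hypotheses `m₁ ≤ κ·Aa k σ` (all filaments, all σ) and `κ·Aa j σ ≤ m₂` for `|σ − c_j| ≤ √m₂` (`κ = e^{−(1+γ_E−log 2)}`); the
stub file derives them from `Λ⁻¹ ≤ Aa` (`NearStraightJ1G`) and the cone clause of `FlatJ1G` (`m₁ = κ/Λ`, `m₂ = 5κ·KA`).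
Lane ns-filament-19175-p1 g11; `--supports stmt-NavierStokesRegularity-27849`.  HONEST FRAMING: bookkeeping about a HYPOTHETICAL filament skeleton on
the NEGATIVE side of a MODEL route; nothing here bears on Navier–Stokes regularity or blow-up.
-/

set_option linter.dupNamespace false

noncomputable section

namespace Summit.NavierStokesRegularity.NavierStokesRegularity.Theorems.MatchedKernel

open Set Function Filter MeasureTheory Real
open Literature.Analysis.FluidPDE
open Summit.NavierStokesRegularity.NavierStokesRegularity.Theorems.SelectionBoxRJRung
open scoped InnerProductSpace Topology

/-- The numerical side of the matched threshold: above `Γ₁₂` the self errors satisfy `E₂ + 4E₁ ≤ (1/3)/m₂` and the rotation dominates,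
`6P + 2θ₀⁻¹ + 1 < (Γθ₀/4π) ((4/3)/m₂ − E₂ − 4E₁)`. [folklore] -/
theorem matched_clause12_thresholds {N : ℕ} {Γ ρ K Rw cg θ₀ m₁ m₂ : ℝ} (hρ : 0 < ρ) (hRw : 0 < Rw) (hcg : 0 < cg)
    (hθ₀ : 0 < θ₀) (hm₁ : 0 < m₁) (hm₂ : 0 < m₂) (hΓ0 : 1 ≤ Γ) (hΓ2 : (7104 * Real.pi * K * m₂) ^ 2 / m₁ ≤ Γ)
    (hΓ3 : 312 * Real.pi * m₂ * (cg * ρ + 2 * Rw) / (cg ^ 4 * ρ ^ 3) ≤ Γ)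
    (hΓ4 : 4 * Real.pi * m₂ * (12 * N * (ρ + 2 * Rw) / (θ₀ * cg * ρ ^ 3) + 2 * θ₀⁻¹ + 2) / θ₀ ≤ Γ) :
    (416 * Real.pi * (K / Real.sqrt Γ) / Real.sqrt m₁ + 20 * Real.pi * (cg * ρ * Real.sqrt Γ + 2 * Rw * Real.sqrt Γ) /
        (cg * (cg * ρ * Real.sqrt Γ) ^ 3)) +
      4 * (192 * Real.pi * (K / Real.sqrt Γ) / Real.sqrt m₁ + 8 * Real.pi * (cg * ρ * Real.sqrt Γ + 2 * Rw * Real.sqrt Γ) /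
        (cg * (cg * ρ * Real.sqrt Γ) ^ 3)) ≤ 1 / 3 / m₂ ∧
    ∀ Q a : ℝ, Γ * θ₀ / (4 * Real.pi) ≤ Q → |a| ≤ θ₀⁻¹ →
      6 * (N * (Γ * θ₀⁻¹ / (4 * Real.pi) * (8 * Real.pi * (ρ * Real.sqrt Γ + 2 * Rw * Real.sqrt Γ) /
        (cg * (ρ * Real.sqrt Γ) ^ 3)))) + 2 * |a| + 1 <
      Q * (4 / 3 / m₂ - (416 * Real.pi * (K / Real.sqrt Γ) / Real.sqrt m₁ + 20 * Real.pi * (cg * ρ * Real.sqrt Γ + 2 * Rw * Real.sqrt Γ) /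
        (cg * (cg * ρ * Real.sqrt Γ) ^ 3)) -
        4 * (192 * Real.pi * (K / Real.sqrt Γ) / Real.sqrt m₁ + 8 * Real.pi * (cg * ρ * Real.sqrt Γ + 2 * Rw * Real.sqrt Γ) /
        (cg * (cg * ρ * Real.sqrt Γ) ^ 3))) := by
  have hπ := Real.pi_gt_three
  have hΓ : 0 < Γ := by linarith
  have hG : 0 < Real.sqrt Γ := Real.sqrt_pos.2 hΓ
  have hs1 : 0 < Real.sqrt m₁ := Real.sqrt_pos.2 hm₁
  -- rescale the two majorant constants
  have hr1 : 8 * Real.pi * (cg * ρ * Real.sqrt Γ + 2 * Rw * Real.sqrt Γ) / (cg * (cg * ρ * Real.sqrt Γ) ^ 3) =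
      8 * Real.pi * (cg * ρ + 2 * Rw) / (cg * (cg * ρ) ^ 3 * Γ) := majorant_const_rescale hΓ _ _ _ _
  have hr2 : 8 * Real.pi * (ρ * Real.sqrt Γ + 2 * Rw * Real.sqrt Γ) / (cg * (ρ * Real.sqrt Γ) ^ 3) =
      8 * Real.pi * (ρ + 2 * Rw) / (cg * ρ ^ 3 * Γ) := majorant_const_rescale hΓ _ _ _ _
  have hr3 : 20 * Real.pi * (cg * ρ * Real.sqrt Γ + 2 * Rw * Real.sqrt Γ) / (cg * (cg * ρ * Real.sqrt Γ) ^ 3) =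
      (5 / 2) * (8 * Real.pi * (cg * ρ * Real.sqrt Γ + 2 * Rw * Real.sqrt Γ) / (cg * (cg * ρ * Real.sqrt Γ) ^ 3)) := by
    ring
  rw [hr3, hr1, hr2]
  -- the `K/(√Γ √m₁)` terms: `π K /(√Γ √m₁) ≤ 1/(7104 m₂)`
  have hK1 : Real.pi * (K / Real.sqrt Γ) / Real.sqrt m₁ ≤ 1 / (7104 * m₂) := by
    have h0 : (7104 * Real.pi * K * m₂) ^ 2 ≤ Γ * m₁ := by rwa [div_le_iff₀ hm₁] at hΓ2
    have h1 : |7104 * Real.pi * K * m₂| ≤ Real.sqrt Γ * Real.sqrt m₁ := by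
      rw [← Real.sqrt_sq_eq_abs, ← Real.sqrt_mul hΓ.le]
      exact Real.sqrt_le_sqrt h0
    have h2 : 7104 * Real.pi * K * m₂ ≤ Real.sqrt Γ * Real.sqrt m₁ := (le_abs_self _).trans h1
    have e : Real.pi * (K / Real.sqrt Γ) / Real.sqrt m₁ = (Real.pi * K) / (Real.sqrt Γ * Real.sqrt m₁) := by
      rw [mul_div_assoc', div_div]
    rw [e, div_le_div_iff₀ (mul_pos hG hs1) (by positivity)]
    nlinarith
  -- the `1/Γ` terms
  have hK2 : 8 * Real.pi * (cg * ρ + 2 * Rw) / (cg * (cg * ρ) ^ 3 * Γ) ≤ 1 / (39 * m₂) := by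
    rw [div_le_div_iff₀ (by positivity) (by positivity)]
    have h1 : 312 * Real.pi * m₂ * (cg * ρ + 2 * Rw) ≤ Γ * (cg ^ 4 * ρ ^ 3) := (div_le_iff₀ (by positivity)).1 hΓ3
    nlinarith
  have h6 : (1 : ℝ) / (7104 * m₂) = (1 / 7104) * m₂⁻¹ := by rw [one_div, mul_inv, one_div]
  have h39 : (1 : ℝ) / (39 * m₂) = (1 / 39) * m₂⁻¹ := by rw [one_div, mul_inv, one_div]
  have hm2i : 0 < m₂⁻¹ := inv_pos.2 hm₂
  have hE : (5 / 2) * (8 * Real.pi * (cg * ρ + 2 * Rw) / (cg * (cg * ρ) ^ 3 * Γ)) +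
        416 * (Real.pi * (K / Real.sqrt Γ) / Real.sqrt m₁) +
      4 * (192 * (Real.pi * (K / Real.sqrt Γ) / Real.sqrt m₁) + 8 * Real.pi * (cg * ρ + 2 * Rw) / (cg * (cg * ρ) ^ 3 * Γ)) ≤
        1 / 3 / m₂ := by
    rw [h6] at hK1; rw [h39] at hK2
    rw [div_eq_mul_inv (1 / 3 : ℝ)]
    nlinarith
  have e1 : 416 * Real.pi * (K / Real.sqrt Γ) / Real.sqrt m₁ = 416 * (Real.pi * (K / Real.sqrt Γ) / Real.sqrt m₁) := by ring
  have e2 : 192 * Real.pi * (K / Real.sqrt Γ) / Real.sqrt m₁ = 192 * (Real.pi * (K / Real.sqrt Γ) / Real.sqrt m₁) := by ring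
  rw [e1, e2]
  constructor
  · linarith
  · intro Q a hQ ha
    -- the partner constant is `Γ`-free
    have hP : N * (Γ * θ₀⁻¹ / (4 * Real.pi) * (8 * Real.pi * (ρ + 2 * Rw) / (cg * ρ ^ 3 * Γ))) =
        2 * N * (ρ + 2 * Rw) / (θ₀ * cg * ρ ^ 3) := by
      field_simp
      ring
    rw [hP]
    have hQ' : 12 * N * (ρ + 2 * Rw) / (θ₀ * cg * ρ ^ 3) + 2 * θ₀⁻¹ + 2 ≤ Γ * θ₀ / (4 * Real.pi) * m₂⁻¹ := by
      have h := (div_le_iff₀ hθ₀).1 hΓ4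
      have e : Γ * θ₀ / (4 * Real.pi) * m₂⁻¹ = Γ * θ₀ / (4 * Real.pi * m₂) := by
        rw [← div_eq_mul_inv, div_div]
      rw [e, le_div_iff₀ (by positivity)]
      linarith
    have hN0 : 0 ≤ 12 * N * (ρ + 2 * Rw) / (θ₀ * cg * ρ ^ 3) := by positivity
    have hQ0 : 0 ≤ Q := le_trans (by positivity) hQ
    have hfac : m₂⁻¹ ≤ 4 / 3 / m₂ - (416 * (Real.pi * (K / Real.sqrt Γ) / Real.sqrt m₁) +
        (5 / 2) * (8 * Real.pi * (cg * ρ + 2 * Rw) / (cg * (cg * ρ) ^ 3 * Γ))) -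
        4 * (192 * (Real.pi * (K / Real.sqrt Γ) / Real.sqrt m₁) + 8 * Real.pi * (cg * ρ + 2 * Rw) / (cg * (cg * ρ) ^ 3 * Γ)) := by
      have : 4 / 3 / m₂ = (4 / 3) * m₂⁻¹ := div_eq_mul_inv _ _
      have : 1 / 3 / m₂ = (1 / 3) * m₂⁻¹ := div_eq_mul_inv _ _
      linarith
    have hmul : Q * m₂⁻¹ ≤ Q * (4 / 3 / m₂ - (416 * (Real.pi * (K / Real.sqrt Γ) / Real.sqrt m₁) +
        (5 / 2) * (8 * Real.pi * (cg * ρ + 2 * Rw) / (cg * (cg * ρ) ^ 3 * Γ))) -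
        4 * (192 * (Real.pi * (K / Real.sqrt Γ) / Real.sqrt m₁) + 8 * Real.pi * (cg * ρ + 2 * Rw) / (cg * (cg * ρ) ^ 3 * Γ))) :=
      mul_le_mul_of_nonneg_left hfac hQ0
    have hQm : Γ * θ₀ / (4 * Real.pi) * m₂⁻¹ ≤ Q * m₂⁻¹ := mul_le_mul_of_nonneg_right hQ hm2i.le
    have h1 : 6 * (2 * (N : ℝ) * (ρ + 2 * Rw) / (θ₀ * cg * ρ ^ 3)) = 12 * N * (ρ + 2 * Rw) / (θ₀ * cg * ρ ^ 3) := by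
      ring
    rw [h1]
    calc _ < Q * m₂⁻¹ := by linarith
      _ ≤ _ := hmul

/-! ### Clause 12 from the other clauses, matched kernel -/

/-- **Clause 12 is implied, MATCHED kernel (regime `2Kρ ≤ 1`, cores `κ·Aa ∈ [m₁, m₂]`, `Γ ≥ Γ₁₂(m₁, m₂, …)`).**  For a skeleton
datum satisfying clauses 2, 3, 4, 5, 7, 8, 10 and `w_j(c_j) = 0`, `3/2 + δ ≤ w_j′(c_j)` of `SkeletonJ1G`'s matrix (with `u`, `v` given by
their defining formulas, matched kernel), differentiable core areas with `m₁ ≤ κ·Aa k σ` everywhere and `κ·Aa j σ ≤ m₂` on the rotation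
windows `|σ − c_j| ≤ √m₂` (`κ = e^{−(1+γ_E−log 2)}`), and `Γ` above the four explicit thresholds `exp((Rw/Rb)² + 1)`,
`(7104 π K m₂)²/m₁`, `312 π m₂ (cg ρ + 2Rw)/(cg⁴ ρ³)`, `4π m₂ (12 N (ρ + 2Rw)/(θ₀ cg ρ³) + 2θ₀⁻¹ + 2)/θ₀`: every filament `j` and every
orthonormal completion `(m, n)` of `X_j′(c_j)` satisfy `⟪A m, m⟫ + ⟪A n, n⟫ < 0 ∧ ⟪A n, m⟫⟪A m, n⟫ < ⟪A m, m⟫⟪A n, n⟫`, `A = Dv(X_j(c_j))`.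
[folklore] -/
theorem matched_clause12_of_skeleton_core {N : ℕ} {Γ δ ρ K Rw Rb cg θ₀ m₁ m₂ : ℝ} (hδ : 0 < δ) (hρ : 0 < ρ) (hRw : 0 < Rw)
    (hRb : 0 < Rb) (hcg : 0 < cg) (hθ₀ : 0 < θ₀) (hm₁ : 0 < m₁) (hm₂ : 0 < m₂) (hKρ : 2 * K * ρ ≤ 1)
    (hΓ1 : Real.exp ((Rw / Rb) ^ 2 + 1) ≤ Γ) (hΓ2 : (7104 * Real.pi * K * m₂) ^ 2 / m₁ ≤ Γ)
    (hΓ3 : 312 * Real.pi * m₂ * (cg * ρ + 2 * Rw) / (cg ^ 4 * ρ ^ 3) ≤ Γ)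
    (hΓ4 : 4 * Real.pi * m₂ * (12 * N * (ρ + 2 * Rw) / (θ₀ * cg * ρ ^ 3) + 2 * θ₀⁻¹ + 2) / θ₀ ≤ Γ)
    {γ : Fin N → ℝ} {α : ℝ} {X : Fin N → ℝ → EuclideanSpace ℝ (Fin 3)} {w : Fin N → ℝ → ℝ} {c : Fin N → ℝ}
    {Aa : Fin N → ℝ → ℝ}
    {u : (Fin N → ℝ → EuclideanSpace ℝ (Fin 3)) → EuclideanSpace ℝ (Fin 3) → EuclideanSpace ℝ (Fin 3)}
    {v : EuclideanSpace ℝ (Fin 3) → EuclideanSpace ℝ (Fin 3)}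
    (hu : ∀ Z y, u Z y = ∑ k, (Γ * γ k / (4 * Real.pi)) •
      ∫ σ : ℝ, ((‖y - Z k σ‖ ^ 2 + Real.exp (-(1 + Real.eulerMascheroniConstant - Real.log 2)) * Aa k σ) ^ (3 / 2 : ℝ))⁻¹ •
        cross (deriv (Z k) σ) (y - Z k σ))
    (hA : ∀ k, Differentiable ℝ (Aa k))
    (hm₁A : ∀ k σ, m₁ ≤ Real.exp (-(1 + Real.eulerMascheroniConstant - Real.log 2)) * Aa k σ)
    (hm₂A : ∀ j σ, |σ - c j| ≤ Real.sqrt m₂ → Real.exp (-(1 + Real.eulerMascheroniConstant - Real.log 2)) * Aa j σ ≤ m₂)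
    (hv : ∀ y, v y = u X y + (1 / 2 : ℝ) • y - α • cross (EuclideanSpace.single 2 1) y)
    (hreg : ∀ j, ContDiff ℝ 2 (X j) ∧ Differentiable ℝ (w j) ∧ (∀ τ, ‖deriv (X j) τ‖ = 1) ∧
      (∀ τ, ‖iteratedDeriv 2 (X j) τ‖ * Real.sqrt Γ ≤ K))
    (hsep : ∀ j k, j ≠ k → ∀ τ σ, ρ * Real.sqrt Γ ≤ ‖X j τ - X k σ‖)
    (hnoret : ∀ j τ σ, ρ * Real.sqrt Γ ≤ |τ - σ| → cg * ρ * Real.sqrt Γ ≤ ‖X j τ - X j σ‖)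
    (hesc : ∀ j τ, cg * |τ - c j| ≤ Rw * Real.sqrt Γ + ‖X j τ‖)
    (htan : ∀ j τ, ‖X j τ‖ ≤ Rb * Real.sqrt (Γ * Real.log Γ) → v (X j τ) = w j τ • deriv (X j) τ)
    (hwaist : ∀ j, ‖X j (c j)‖ ≤ Rw * Real.sqrt Γ)
    (hbds : θ₀ ≤ |α| ∧ |α| ≤ θ₀⁻¹ ∧ ∀ j, θ₀ ≤ |γ j| ∧ |γ j| ≤ θ₀⁻¹)
    (hstag : ∀ j, w j (c j) = 0 ∧ 3 / 2 + δ ≤ deriv (w j) (c j))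
    (j : Fin N) {m n : EuclideanSpace ℝ (Fin 3)} (hon : Orthonormal ℝ ![deriv (X j) (c j), m, n]) :
    ⟪fderiv ℝ v (X j (c j)) m, m⟫_ℝ + ⟪fderiv ℝ v (X j (c j)) n, n⟫_ℝ < 0 ∧
    ⟪fderiv ℝ v (X j (c j)) n, m⟫_ℝ * ⟪fderiv ℝ v (X j (c j)) m, n⟫_ℝ <
      ⟪fderiv ℝ v (X j (c j)) m, m⟫_ℝ * ⟪fderiv ℝ v (X j (c j)) n, n⟫_ℝ := by
  have hπ := Real.pi_gt_three
  have hΓ0 : 1 ≤ Γ := le_trans (Real.one_le_exp (by positivity)) hΓ1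
  have hΓ : 0 < Γ := by linarith
  have hG : 0 < Real.sqrt Γ := Real.sqrt_pos.2 hΓ
  -- the frame velocity as an explicit function
  obtain ⟨coef, hcoef⟩ : ∃ coef : Fin N → ℝ, coef = fun k => Γ * γ k / (4 * Real.pi) := ⟨_, rfl⟩
  set κ : ℝ := Real.exp (-(1 + Real.eulerMascheroniConstant - Real.log 2)) with hκ
  have hmcc : ∀ k, Continuous ((fun k σ => κ * Aa k σ) k) := fun k => by
    dsimp only; exact continuous_const.mul (hA k).continuous
  have hmm : ∀ k σ, m₁ ≤ (fun k σ => κ * Aa k σ) k σ := fun k σ => by dsimp only; exact hm₁A k σ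
  have hmm₂ : ∀ σ, |σ - c j| ≤ Real.sqrt m₂ → (fun k σ => κ * Aa k σ) j σ ≤ m₂ := fun σ hσ => by dsimp only; exact hm₂A j σ hσ
  have hvfun : v = fun y : EuclideanSpace ℝ (Fin 3) =>
      (∑ k, coef k • ∫ σ : ℝ, ((‖y - X k σ‖ ^ 2 + (fun k σ => κ * Aa k σ) k σ) ^ (3 / 2 : ℝ))⁻¹ • cross (deriv (X k) σ) (y - X k σ))
        + (1 / 2 : ℝ) • y - α • cross (EuclideanSpace.single 2 1) y := by
    funext y; rw [hv y, hu X y, hcoef]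
  -- hypotheses of the Biot–Savart stubs for every filament
  have hX1 : ∀ k, ContDiff ℝ 1 (X k) := fun k => (hreg k).1.of_le (by norm_num)
  have hdX : ∀ k τ, ‖deriv (X k) τ‖ ≤ 1 := fun k τ => ((hreg k).2.2.1 τ).le
  have hgrow : ∀ k τ, cg * |τ| - (cg * |c k| + Rw * Real.sqrt Γ) ≤ ‖X k τ‖ := by
    intro k τ
    have h1 := hesc k τ
    have h2 : |τ| - |c k| ≤ |τ - c k| := abs_sub_abs_le_abs_sub τ (c k)
    nlinarith [hcg]
  -- geometry of filament `j` seen from its stagnation point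
  obtain ⟨hXj, hwj, hunit, hcurv⟩ := hreg j
  have hκ' : ∀ τ, ‖deriv (deriv (X j)) τ‖ ≤ K / Real.sqrt Γ := fun τ => by
    rw [le_div_iff₀ hG, ← iteratedDeriv_one (f := X j), ← iteratedDeriv_succ]; exact hcurv τ
  have hS₁ : K / Real.sqrt Γ * (ρ * Real.sqrt Γ) ≤ 1 / 2 := by
    rw [show K / Real.sqrt Γ * (ρ * Real.sqrt Γ) = K * ρ by field_simp]; linarith
  have hD₁ : 0 < cg * ρ * Real.sqrt Γ := by positivity
  have hA₁ : 0 ≤ 2 * Rw * Real.sqrt Γ := by positivity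
  have hfar : ∀ τ, ρ * Real.sqrt Γ ≤ |τ - c j| → cg * ρ * Real.sqrt Γ ≤ ‖X j (c j) - X j τ‖ := fun τ hτ =>
    hnoret j (c j) τ (by rwa [abs_sub_comm])
  have hescj : ∀ τ, cg * |τ - c j| - 2 * Rw * Real.sqrt Γ ≤ ‖X j (c j) - X j τ‖ := fun τ => by
    have h1 := hesc j τ
    have h2 := hwaist j
    have h3 : ‖X j τ‖ - ‖X j (c j)‖ ≤ ‖X j (c j) - X j τ‖ := by
      rw [norm_sub_rev]; exact norm_sub_norm_le _ _
    linarith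
  -- the partners seen from the stagnation point
  have hpfar : ∀ k, k ≠ j → ∀ τ, ρ * Real.sqrt Γ ≤ ‖X j (c j) - X k τ‖ := fun k hk τ => hsep j k hk.symm (c j) τ
  have hpesc : ∀ k, k ≠ j → ∀ τ, cg * |τ - c k| - 2 * Rw * Real.sqrt Γ ≤ ‖X j (c j) - X k τ‖ := fun k _ τ => by
    have h1 := hesc k τ
    have h2 := hwaist j
    have h3 : ‖X k τ‖ - ‖X j (c j)‖ ≤ ‖X j (c j) - X k τ‖ := by
      rw [norm_sub_rev]; exact norm_sub_norm_le _ _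
    linarith
  have hCκ0 : 0 ≤ Γ * θ₀⁻¹ / (4 * Real.pi) := by positivity
  have hCκ : ∀ k, k ≠ j → |coef k| ≤ Γ * θ₀⁻¹ / (4 * Real.pi) := fun k _ => by
    rw [hcoef]; dsimp only
    rw [abs_div, abs_mul, abs_of_pos hΓ, abs_of_pos (by positivity : (0:ℝ) < 4 * Real.pi)]
    exact div_le_div_of_nonneg_right (mul_le_mul_of_nonneg_left (hbds.2.2 k).2 hΓ.le) (by positivity)
  have hQ : Γ * θ₀ / (4 * Real.pi) ≤ |coef j| := by
    rw [hcoef]; dsimp only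
    rw [abs_div, abs_mul, abs_of_pos hΓ, abs_of_pos (by positivity : (0:ℝ) < 4 * Real.pi)]
    exact div_le_div_of_nonneg_right (mul_le_mul_of_nonneg_left (hbds.2.2 j).1 hΓ.le) (by positivity)
  -- thresholds
  obtain ⟨-, hbigQ⟩ := matched_clause12_thresholds (N := N) hρ hRw hcg hθ₀ hm₁ hm₂ hΓ0 hΓ2 hΓ3 hΓ4
  have hbig := hbigQ |coef j| α hQ hbds.2.1
  -- the determinant half
  have hdet := matched_normalBlock_det_pos (coef := coef) (α := α) (u₀ := c) (mc := fun k σ => κ * Aa k σ)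
    hm₁ hmm hmcc hm₂ hmm₂ hcg hX1 hdX hgrow hXj hunit hκ' hS₁
    hcg hD₁ hA₁ hfar hescj (mul_pos hρ hG) hcg hA₁ hpfar hpesc hCκ0 hCκ hon hbig
  -- the trace half: trace `3/2`, the tangent is an eigenvector with eigenvalue `w′(c) ≥ 3/2 + δ`
  have htr : ∀ {ι : Type} [Fintype ι] (b : OrthonormalBasis ι ℝ (EuclideanSpace ℝ (Fin 3))),
      ∑ i, ⟪b i, fderiv ℝ v (X j (c j)) (b i)⟫_ℝ = 3 / 2 := by
    intro ι _ b
    have h := matchedSkeletonField_trace_eq (m := fun k σ => κ * Aa k σ) (coef := coef) (α := α)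
      hm₁ hmm hmcc hcg hX1 hdX hgrow b (X j (c j))
    rw [hvfun]; exact h
  have hdiffv : DifferentiableAt ℝ v (X j (c j)) := by
    by_contra h
    have h1 := htr (EuclideanSpace.basisFun (Fin 3) ℝ)
    rw [fderiv_zero_of_not_differentiableAt h] at h1
    norm_num at h1
  have hball : ∀ᶠ τ in 𝓝 (c j), v (X j τ) = w j τ • deriv (X j) τ := by
    have hlog : (Rw / Rb) ^ 2 < Real.log Γ := by
      have h := (Real.le_log_iff_exp_le hΓ).2 hΓ1
      linarith
    have hlt : Rw * Real.sqrt Γ < Rb * Real.sqrt (Γ * Real.log Γ) := by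
      have h1 : Rw / Rb < Real.sqrt (Real.log Γ) := (Real.lt_sqrt (by positivity)).2 hlog
      have h2 : Rw < Rb * Real.sqrt (Real.log Γ) := by rwa [div_lt_iff₀' hRb] at h1
      calc Rw * Real.sqrt Γ < (Rb * Real.sqrt (Real.log Γ)) * Real.sqrt Γ := mul_lt_mul_of_pos_right h2 hG
        _ = Rb * Real.sqrt (Γ * Real.log Γ) := by rw [Real.sqrt_mul hΓ.le]; ring
    have hopen : IsOpen {τ : ℝ | ‖X j τ‖ < Rb * Real.sqrt (Γ * Real.log Γ)} :=
      isOpen_lt (hXj.continuous.norm) continuous_const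
    have hmem : c j ∈ {τ : ℝ | ‖X j τ‖ < Rb * Real.sqrt (Γ * Real.log Γ)} := lt_of_le_of_lt (hwaist j) hlt
    exact Filter.eventually_of_mem (hopen.mem_nhds hmem) fun τ hτ => htan j τ (le_of_lt hτ)
  have hAt : fderiv ℝ v (X j (c j)) (deriv (X j) (c j)) = deriv (w j) (c j) • deriv (X j) (c j) :=
    box_eigenvector_law hXj hwj (hstag j).1 hdiffv hball
  have htrace := normalBlock_trace_neg (fderiv ℝ v (X j (c j))) hon hAt htr hδ (hstag j).2
  refine ⟨htrace, ?_⟩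
  rw [hvfun]
  exact hdet

end Summit.NavierStokesRegularity.NavierStokesRegularity.Theorems.MatchedKernel
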